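import Mathlib
import Literature.AlgebraicGeometry.Resolution.PerronTransforms
import HarnessLib

/-!
# Perron's Lemma 4.2 for a finite set: a POSITIVE value basis in which prescribed elements have non-negative exponents (Knaf–Kuhlmann 2005, §4)

Route `RadicialJung`, crux `CleanModels` (stmt-ResolutionOfSingularities-15917), line `Sketch` rev 35; explicit-unit seat `decomp-res-hand-1` g3.
GROUNDWORK (lemma M2 of `Cruxes/CleanModels/Lines/Sketch-memo-hand1-g3.md` §4) for the discharge of the printed input
`Literature.AlgebraicGeometry.Resolution.KnafKuhlmann2005_Thm11_monomialForm` (Knaf–Kuhlmann 2005, Thm. 1.1 WITH its monomial clause).  Knaf–Kuhlmann,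
proof of Thm. 1.1, p. 13 («Moreover» clause): given `x₁,…,x_r ∈ F` whose values form a ℤ-basis of `v F` (lemma M1, `…KK05ValueBasis`) and a finite
`Z ⊆ 𝒪_P`, Lemma 4.2 (Perron transforms — the tree's PROVED `PerronTransforms.exists_basis_lt_one_of_injective`) replaces `x` by Laurent monomials `x'`
in `x` with POSITIVE values, again a ℤ-basis of `v F`, such that every non-zero `ζ ∈ Z` has `v ζ = v(x'^μ)` with `μ ∈ ℕ^{r}`, i.e. `ζ = u_ζ · x'^μ` with
`v u_ζ = 0`.  This file is exactly that step, in the ambient-field vocabulary of `FiniteExtensionUniformization.lean`: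

* `exists_positiveBasis_monomialValues` — from `x : Fin r → F` non-zero with `∏ v(xᵢ)^{mᵢ} = 1 → m = 0` and `∀ a ∈ F ∖ 0, v a ∈ ∏ v(xᵢ)^ℤ`, and a finite
  `Z ⊆ V`: there are `x' : Fin r' → F` non-zero, `v x'ⱼ < 1`, Laurent monomials in `x`, with the same two properties, and for every non-zero `ζ ∈ Z` an
  exponent `μ : Fin r' → ℕ` and a `u ∈ F` with `v u = 1` and `ζ = u · ∏ x'ⱼ^{μⱼ}`.

OURS (bookkeeping over the landed Perron lemma); proves nothing about resolution of singularities in characteristic `p`. counted 0.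
-/

noncomputable section

set_option linter.dupNamespace false -- mandated namespace of this single-conjunct summit

open Literature.AlgebraicGeometry.Resolution

namespace Summit.ResolutionOfSingularities.ResolutionOfSingularities.Theorems.RadicialJung.CleanModels

namespace KK05ValueBasis

universe u

variable {Ω : Type u} [Field Ω]

/-- **Perron's lemma for a finite set** (Knaf–Kuhlmann 2005, Lemma 4.2 as used on p. 13).  Let `V` be a valuation ring of `Ω`, `F ⊆ Ω` a subfield and
`x₁,…,x_r ∈ F` non-zero elements whose values are ℤ-independent and generate the values of `F ∖ 0`.  For every finite `Z ⊆ V` there are non-zero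
`x'₁,…,x'_{r'} ∈ F` of values `< 1`, Laurent monomials in `x`, whose values are again ℤ-independent and generate, such that every non-zero `ζ ∈ Z` is
`u · ∏ x'ⱼ^{μⱼ}` with `μⱼ ∈ ℕ` and `v u = 1`. [cite: KnafKuhlmann2005, Lemma 4.2 and proof of Thm. 1.1 (p. 13)] -/
theorem exists_positiveBasis_monomialValues (V : ValuationSubring Ω) (F : Subfield Ω) {r : ℕ} (x : Fin r → Ω)
    (hxF : ∀ i, x i ∈ F ∧ x i ≠ 0)
    (hind : ∀ m : Fin r → ℤ, (∏ i, V.valuation (x i) ^ (m i)) = 1 → m = 0)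
    (hgen : ∀ a ∈ F, a ≠ 0 → ∃ m : Fin r → ℤ, V.valuation a = ∏ i, V.valuation (x i) ^ (m i))
    (Z : Finset Ω) (hZ : ∀ z ∈ Z, z ∈ V) :
    ∃ (r' : ℕ) (x' : Fin r' → Ω), (∀ j, x' j ∈ F ∧ x' j ≠ 0) ∧ (∀ j, V.valuation (x' j) < 1) ∧
      (∀ j, ∃ n : Fin r → ℤ, x' j = ∏ i, x i ^ (n i)) ∧
      (∀ m : Fin r' → ℤ, (∏ j, V.valuation (x' j) ^ (m j)) = 1 → m = 0) ∧
      (∀ a ∈ F, a ≠ 0 → ∃ m : Fin r' → ℤ, V.valuation a = ∏ j, V.valuation (x' j) ^ (m j)) ∧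
      ∀ z ∈ Z, z ≠ 0 → z ∈ F → ∃ (μ : Fin r' → ℕ) (u : Ω), u ∈ F ∧ V.valuation u = 1 ∧
        z = u * ∏ j, x' j ^ (μ j) := by
  classical
  have hx0 : ∀ i, x i ≠ 0 := fun i => (hxF i).2
  have hv0 : ∀ i, V.valuation (x i) ≠ 0 := fun i => (map_ne_zero V.valuation).mpr (hx0 i)
  -- Laurent monomials in `x`
  let mono : (Fin r → ℤ) → Ω := fun m => ∏ i, x i ^ (m i)
  have hmono0 : ∀ m, mono m ≠ 0 := fun m => Finset.prod_ne_zero_iff.mpr fun i _ => zpow_ne_zero _ (hx0 i)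
  have hmonoF : ∀ m, mono m ∈ F := fun m => prod_mem fun i _ => zpow_mem (hxF i).1 _
  have hvmono : ∀ m, V.valuation (mono m) = ∏ i, V.valuation (x i) ^ (m i) := fun m => by
    simp only [mono, map_prod, map_zpow₀]
  have hmono_add : ∀ m m', mono (m + m') = mono m * mono m' := fun m m' => by
    simp only [mono, Pi.add_apply, zpow_add₀ (hx0 _), Finset.prod_mul_distrib]
  have hmono_zero : mono 0 = 1 := by simp [mono]
  -- values of Laurent monomials, as a homomorphism `φ : ℤ^r → Γˣ`
  let G := (V.ValueGroup)ˣ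
  let w : (Fin r → ℤ) → G := fun m => Units.mk0 (V.valuation (mono m)) ((map_ne_zero V.valuation).mpr (hmono0 m))
  have hw : ∀ m, ((w m : G) : V.ValueGroup) = V.valuation (mono m) := fun m => rfl
  let φ : (Fin r → ℤ) →+ Additive G :=
    { toFun := fun m => Additive.ofMul (w m)
      map_zero' := by
        change Additive.ofMul (w 0) = 0
        rw [ofMul_eq_zero]
        exact Units.ext (by rw [hw, hmono_zero, map_one, Units.val_one])
      map_add' := fun m m' => by
        change Additive.ofMul (w (m + m')) = Additive.ofMul (w m) + Additive.ofMul (w m')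
        rw [← ofMul_mul]
        congr 1
        exact Units.ext (by rw [Units.val_mul, hw, hw, hw, hmono_add, map_mul]) }
  have hφ : ∀ m, Additive.toMul (φ m) = w m := fun m => rfl
  have hφinj : Function.Injective φ := by
    refine (injective_iff_map_eq_zero φ).mpr fun m hm => hind m ?_
    have : w m = 1 := by
      rw [← hφ m, hm, toMul_zero]
    have := congrArg (fun g : G => (g : V.ValueGroup)) this
    simpa only [hw, hvmono, Units.val_one] using this
  haveI : AddGroup.FG (Fin r → ℤ) := Module.Finite.iff_addGroup_fg.mp inferInstance
  -- exponent vectors of the non-zero elements of `Z ∩ F` (and `0` otherwise)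
  have hexp : ∀ z : Ω, ∃ m : Fin r → ℤ, V.valuation (mono m) ≤ 1 ∧
      (z ∈ Z → z ≠ 0 → z ∈ F → V.valuation z = V.valuation (mono m)) := by
    intro z
    by_cases h : z ∈ Z ∧ z ≠ 0 ∧ z ∈ F
    · obtain ⟨m, hm⟩ := hgen z h.2.2 h.2.1
      have hzm : V.valuation z = V.valuation (mono m) := by rw [hm, hvmono]
      exact ⟨m, hzm ▸ (V.valuation_le_one_iff z).mpr (hZ z h.1), fun _ _ _ => hzm⟩
    · exact ⟨0, by rw [hmono_zero, map_one], fun h1 h2 h3 => (h ⟨h1, h2, h3⟩).elim⟩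
  choose mz hmz1 hmz using hexp
  let D : Finset (Fin r → ℤ) := Z.image mz
  have hD : ∀ d ∈ D, Additive.toMul (φ d) ≤ 1 := by
    intro d hd
    obtain ⟨z, -, rfl⟩ := Finset.mem_image.mp hd
    rw [hφ, ← Units.val_le_val, hw, Units.val_one]
    exact hmz1 z
  -- Perron (Knaf–Kuhlmann Lemma 4.2; Temkin Thm. A.2.1): a positive basis with `D` in its ℕ-span
  obtain ⟨e, he1, -, he3⟩ := exists_basis_lt_one_of_injective φ hφinj D hD
  let x' : Fin (Module.finrank ℤ (Fin r → ℤ)) → Ω := fun j => mono (e j)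
  have hx'def : ∀ j, x' j = mono (e j) := fun j => rfl
  -- the key computation: values of monomials in `x'`
  have hwsum : ∀ m : Fin (Module.finrank ℤ (Fin r → ℤ)) → ℤ,
      w (∑ j, m j • e j) = ∏ j, (w (e j)) ^ (m j) := by
    intro m
    have h1 : φ (∑ j, m j • e j) = ∑ j, m j • φ (e j) := by
      rw [map_sum]
      exact Finset.sum_congr rfl fun j _ => map_zsmul φ (m j) (e j)
    rw [← hφ, h1, toMul_sum]
    exact Finset.prod_congr rfl fun j _ => by rw [toMul_zsmul, hφ]
  have key : ∀ m : Fin (Module.finrank ℤ (Fin r → ℤ)) → ℤ,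
      (∏ j, V.valuation (x' j) ^ (m j)) = V.valuation (mono (∑ j, m j • e j)) := by
    intro m
    rw [← hw, hwsum, Units.coe_prod]
    exact Finset.prod_congr rfl fun j _ => by rw [Units.val_zpow_eq_zpow_val, hw, hx'def]
  refine ⟨_, x', fun j => ⟨hmonoF _, hmono0 _⟩, fun j => ?_, fun j => ⟨e j, rfl⟩, ?_, ?_, ?_⟩
  · -- positive values
    have := he1 j
    rw [hφ, ← Units.val_lt_val, hw, Units.val_one] at this
    rw [hx'def]
    exact this
  · -- independence
    intro m hm
    rw [key] at hm
    have h0 : (∑ j, m j • e j) = 0 := hind _ (by rw [← hvmono]; exact hm)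
    funext j
    exact Fintype.linearIndependent_iff.mp e.linearIndependent m h0 j
  · -- generation
    intro a ha ha0
    obtain ⟨m, hm⟩ := hgen a ha ha0
    refine ⟨fun j => e.repr m j, ?_⟩
    rw [key, e.sum_repr m, hvmono]
    exact hm
  · -- the prescribed elements are units times monomials with exponents in `ℕ`
    intro z hz hz0 hzF
    obtain ⟨c, hc⟩ := he3 (mz z) (Finset.mem_image_of_mem mz hz)
    have hc' : mz z = ∑ j, (c j : ℤ) • e j := by
      rw [hc]
      exact Finset.sum_congr rfl fun j _ => (natCast_zsmul (e j) (c j)).symm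
    have hvz : V.valuation z = ∏ j, V.valuation (x' j) ^ (c j : ℤ) := by
      rw [hmz z hz hz0 hzF, key, hc']
    have hP0 : (∏ j, x' j ^ (c j)) ≠ 0 := Finset.prod_ne_zero_iff.mpr fun j _ => pow_ne_zero _ (hmono0 _)
    have hvP : V.valuation (∏ j, x' j ^ (c j)) = ∏ j, V.valuation (x' j) ^ (c j : ℤ) := by
      simp only [map_prod, map_pow, zpow_natCast]
    refine ⟨c, z / ∏ j, x' j ^ (c j), div_mem hzF (prod_mem fun j _ => pow_mem (hmonoF _) _), ?_, ?_⟩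
    · rw [map_div₀, hvP, ← hvz, div_self ((map_ne_zero V.valuation).mpr hz0)]
    · rw [div_mul_cancel₀ _ hP0]

end KK05ValueBasis

end Summit.ResolutionOfSingularities.ResolutionOfSingularities.Theorems.RadicialJung.CleanModels

end
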